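import Literature.Analysis.PDE.TimeExtension
import Mathlib.Analysis.InnerProductSpace.PiL2
import HarnessLib

/-!
# Crux `MixingPayoff` (stmt-NavierStokesRegularity-1422), line `birth`, stub W2
  (`stub_advectionDiffusionSchwartz`): uniform derivative bounds for Seeley's extension

Helper file (lands `--supports stmt-NavierStokesRegularity-1422`). Seeley's extension operator
`Literature.Analysis.Calculus.Seeley.extend T f` (`Calculus/SeeleyExtension.lean`; Seeley 1964)
of a function `f` that is `C^∞` on the closed slab `[0, T] × E` (within) is `C^∞` on
`(-∞, T) × E`; the tree proves this (`Seeley.contDiffOn_extend`) together with termwise bounds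
`‖Dᵐ term_k‖ ≤ |a_k| 2^{km} N K_m` for the locally finite series below the hyperplane. This file
adds the GLOBAL form of the bounds needed to extend drifts with bounded derivatives: if all
within-slab derivatives of `f` are bounded on `[0, T] × E`, then every `Dᵐ (E f)` is bounded on
`(-∞, T) × E` (`seeley_extend_bound`): on `[0, T) × E` the extension is `f` and its free
derivatives are the within-slab ones; below the hyperplane the series of the termwise bounds
converges (`Σ_k |a_k| 2^{km} < ∞`, Seeley's Lemma).
-/

noncomputable section

open Set Function Filter Topology
open scoped ContDiff Topology

-- `Summit = Problem` for this summit; the tree lakefile sets `weak.linter.dupNamespace = false`.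
set_option linter.dupNamespace false

namespace Summit.NavierStokesRegularity.NavierStokesRegularity.Theorems.SelfMixingDichotomy.MixingPayoffBirth

open Literature.Analysis.Calculus Literature.Analysis.Calculus.Seeley

variable {E : Type*} [NormedAddCommGroup E] [NormedSpace ℝ E]
variable {W : Type*} [NormedAddCommGroup W] [NormedSpace ℝ W]

/-- Within-derivatives on the half-open and on the closed slab agree below the top face. -/
theorem iteratedFDerivWithin_Ico_eq_Icc {T : ℝ} (f : ℝ × E → W) {q : ℝ × E} (hq : q.1 < T)
    (m : ℕ) : iteratedFDerivWithin ℝ m f (Ico 0 T ×ˢ univ) q =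
      iteratedFDerivWithin ℝ m f (Icc 0 T ×ˢ univ) q := by
  refine iteratedFDerivWithin_congr_set ?_ m
  have hn : Iio T ×ˢ (univ : Set E) ∈ 𝓝 q := (isOpen_Iio.prod isOpen_univ).mem_nhds ⟨hq, mem_univ _⟩
  filter_upwards [hn] with p hp
  simp only [eq_iff_iff]
  constructor
  · intro h; exact ⟨⟨h.1.1, h.1.2.le⟩, h.2⟩
  · intro h; exact ⟨⟨h.1.1, hp.1⟩, h.2⟩

/-- On `[0, T) × E` the free derivatives of Seeley's extension are the within-slab derivatives of
the data. -/
theorem iteratedFDeriv_extend_of_nonneg [CompleteSpace W] {T : ℝ} (hT : 0 < T) {f : ℝ × E → W}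
    (hf : ContDiffOn ℝ ∞ f (Icc 0 T ×ˢ univ)) {p : ℝ × E} (hp0 : 0 ≤ p.1) (hpT : p.1 < T)
    (m : ℕ) : iteratedFDeriv ℝ m (Seeley.extend T f) p =
      iteratedFDerivWithin ℝ m f (Icc 0 T ×ˢ univ) p := by
  have hslab : Seeley.slab T (univ : Set E) ⊆ Icc 0 T ×ˢ univ := prod_mono Ico_subset_Icc_self le_rfl
  have hext : ContDiffOn ℝ ∞ (Seeley.extend T f) (Iio T ×ˢ univ) :=
    Seeley.contDiffOn_extend hT isOpen_univ (hf.mono hslab)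
  have hat : ContDiffAt ℝ ∞ (Seeley.extend T f) p :=
    hext.contDiffAt ((isOpen_Iio.prod isOpen_univ).mem_nhds ⟨hpT, mem_univ _⟩)
  have hpS : p ∈ Ico 0 T ×ˢ (univ : Set E) := ⟨⟨hp0, hpT⟩, mem_univ _⟩
  have hU : UniqueDiffOn ℝ (Ico 0 T ×ˢ (univ : Set E)) := (uniqueDiffOn_Ico 0 T).prod uniqueDiffOn_univ
  rw [← iteratedFDerivWithin_eq_iteratedFDeriv hU (hat.of_le (mod_cast le_top)) hpS,
    ← iteratedFDerivWithin_Ico_eq_Icc f hpT]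
  refine iteratedFDerivWithin_congr (fun q hq => ?_) hpS m
  exact Seeley.extend_of_nonneg hq.1.1

set_option maxHeartbeats 800000 in
/-- **Global derivative bounds for Seeley's extension.** If `f` is `C^∞` on `[0, T] × E`
(within) with `‖Dʲ f‖ ≤ C_j` (within-slab derivatives) on `[0, T] × E` for every `j`, then for
every `m` there is `C` with `‖Dᵐ (Seeley.extend T f) (t, x)‖ ≤ C` for all `t < T`, `x ∈ E`. -/
theorem seeley_extend_bound [CompleteSpace W] {T : ℝ} (hT : 0 < T) {f : ℝ × E → W}
    (hf : ContDiffOn ℝ ∞ f (Icc 0 T ×ˢ univ))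
    (hb : ∀ j, ∃ C, ∀ p ∈ Icc 0 T ×ˢ (univ : Set E), ‖iteratedFDerivWithin ℝ j f (Icc 0 T ×ˢ univ) p‖ ≤ C)
    (m : ℕ) : ∃ C, ∀ p : ℝ × E, p.1 < T → ‖iteratedFDeriv ℝ m (Seeley.extend T f) p‖ ≤ C := by
  have hslab : Seeley.slab T (univ : Set E) ⊆ Icc 0 T ×ˢ univ := prod_mono Ico_subset_Icc_self le_rfl
  have hf' : ContDiffOn ℝ ∞ f (Seeley.slab T (univ : Set E)) := hf.mono hslab
  -- a common bound `N` for the within-slab derivatives of order `≤ m`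
  choose Cb hCb using hb
  set N : ℝ := ∑ j ∈ Finset.range (m + 1), |Cb j| with hN
  have hN0 : 0 ≤ N := Finset.sum_nonneg fun _ _ => abs_nonneg _
  have hNj : ∀ j ≤ m, ∀ p ∈ Icc 0 T ×ˢ (univ : Set E),
      ‖iteratedFDerivWithin ℝ j f (Icc 0 T ×ˢ univ) p‖ ≤ N := by
    intro j hj p hp
    refine ((hCb j p hp).trans (le_abs_self _)).trans ?_
    exact Finset.single_le_sum (f := fun j => |Cb j|) (fun _ _ => abs_nonneg _)
      (Finset.mem_range.2 (Nat.lt_succ_of_le hj))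
  -- the series of the termwise bounds
  set Sser : ℝ := ∑' k, |Seeley.coeff k| * ((2 : ℝ) ^ k) ^ m * (N * Seeley.leibnizConst T m)
    with hSser
  have hsum := Seeley.summable_abs_coeff_mul_pow_mul m (N * Seeley.leibnizConst T m)
  refine ⟨max N Sser, fun p hpT => ?_⟩
  by_cases hp0 : 0 ≤ p.1
  · -- on the slab: the within derivatives of `f`
    rw [iteratedFDeriv_extend_of_nonneg hT hf hp0 hpT m]
    exact (hNj m le_rfl p ⟨⟨hp0, hpT.le⟩, mem_univ _⟩).trans (le_max_left _ _)
  · -- below the hyperplane: the series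
    push Not at hp0
    have hser := Seeley.hasSum_iteratedFDeriv_term hT isOpen_univ hf' hp0 (mem_univ p.2) m
    have hL : IsOpen (Iio (0 : ℝ) ×ˢ (univ : Set E)) := isOpen_Iio.prod isOpen_univ
    have hpL : p ∈ Iio (0 : ℝ) ×ˢ (univ : Set E) := ⟨hp0, mem_univ _⟩
    rw [iteratedFDerivWithin_of_isOpen m hL hpL] at hser
    have hterm : ∀ k, ‖iteratedFDeriv ℝ m (Seeley.term T f k) p‖ ≤
        |Seeley.coeff k| * ((2 : ℝ) ^ k) ^ m * (N * Seeley.leibnizConst T m) := by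
      intro k
      by_cases hk : -1 < 2 ^ k * p.1 / T
      · have hmem := Seeley.scale_mem_Ioo hT hp0 (mem_univ p.2) hk (B := (univ : Set E))
        have hNk : ∀ j ≤ m, ‖iteratedFDerivWithin ℝ j f (Seeley.slab T univ) (Seeley.scale k p)‖ ≤ N := by
          intro j hj
          have h1 : (Seeley.scale k p).1 < T := hmem.1.2
          rw [show Seeley.slab T (univ : Set E) = Ico 0 T ×ˢ univ from rfl,
            iteratedFDerivWithin_Ico_eq_Icc f h1]
          exact hNj j hj _ ⟨⟨hmem.1.1.le, hmem.1.2.le⟩, mem_univ _⟩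
        have h := Seeley.norm_iteratedFDeriv_term_le_of_bound hT isOpen_univ hf' hp0 (mem_univ p.2) hk hNk
        calc _ ≤ |Seeley.coeff k| * (2 ^ k) ^ m * N * Seeley.leibnizConst T m := h
          _ = _ := by ring
      · have hlt : 2 ^ k * p.1 / T < -1 / 2 := by linarith [not_lt.1 hk]
        rw [Seeley.iteratedFDeriv_term_of_lt hlt m, norm_zero]
        have := Seeley.leibnizConst_nonneg hT m
        positivity
    have hle : ‖iteratedFDeriv ℝ m (Seeley.extend T f) p‖ ≤ Sser :=
      hser.norm_le_of_bounded hsum.hasSum hterm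
    exact hle.trans (le_max_right _ _)

/-- Anchor (registered sub-stub of stub W2): `iteratedFDerivWithin_Ico_eq_Icc` on `ℝ × ℝ³`,
closed form (for the record). -/
theorem w2aux_icoIccWithin : ∀ (T : ℝ) (f : ℝ × EuclideanSpace ℝ (Fin 3) → ℝ)
    (q : ℝ × EuclideanSpace ℝ (Fin 3)), q.1 < T → ∀ m : ℕ,
    iteratedFDerivWithin ℝ m f (Ico 0 T ×ˢ univ) q = iteratedFDerivWithin ℝ m f (Icc 0 T ×ˢ univ) q :=
  fun _ f _ hq m => iteratedFDerivWithin_Ico_eq_Icc f hq m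

end Summit.NavierStokesRegularity.NavierStokesRegularity.Theorems.SelfMixingDichotomy.MixingPayoffBirth

end
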